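import Literature.NumberTheory.Sieve.GoldbachLinnikRomanovCertDefs
import Literature.NumberTheory.Sieve.GoldbachLinnikRomanovCertData1
import Literature.NumberTheory.Sieve.GoldbachLinnikRomanovCertData2

/-!
# Romanov certificate — head sums 3/7

Kernel evaluation (`decide +kernel`) of the checker of `GoldbachLinnikRomanovCertDefs.lean` on the records
`parseRecs 20000 (digitsOf (fsegs1 ++ fsegs2))` of `GoldbachLinnikRomanovCertData1/2.lean`; soundness: `GoldbachLinnikRomanovCertSound1.lean`,
`GoldbachLinnikRomanovCertTop.lean`. [folklore]
-/

namespace Literature.NumberTheory.Sieve.RomanovCert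

set_option maxHeartbeats 0 in
/-- The head accumulators `(T⁺, T⁻, I, S⁺, S⁻, ok)` on `d ∈ [8, 16)`. [folklore] -/
theorem head_8 : headSums (parseRecs 20000 (digitsOf (fsegs1 ++ fsegs2))) 8 8 = (4841654092205076610, 4843021620061995365, 0, 16222433149483134962488, 16305280212872040748986, true) := by
  decide +kernel

set_option maxHeartbeats 0 in
/-- The head accumulators `(T⁺, T⁻, I, S⁺, S⁻, ok)` on `d ∈ [16, 32)`. [folklore] -/
theorem head_16 : headSums (parseRecs 20000 (digitsOf (fsegs1 ++ fsegs2))) 16 16 = (4338063782556882374, 4338720476519450860, 157008095748, 15716725472484499330457, 15806425019439526591047, true) := by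
  decide +kernel

set_option maxHeartbeats 0 in
/-- The head accumulators `(T⁺, T⁻, I, S⁺, S⁻, ok)` on `d ∈ [32, 64)`. [folklore] -/
theorem head_32 : headSums (parseRecs 20000 (digitsOf (fsegs1 ++ fsegs2))) 32 32 = (3968765089094081015, 3966567367744888608, 625050488009, 15632298326577327019207, 15703818089347778004381, true) := by
  decide +kernel

set_option maxHeartbeats 0 in
/-- The head accumulators `(T⁺, T⁻, I, S⁺, S⁻, ok)` on `d ∈ [64, 128)`. [folklore] -/
theorem head_64 : headSums (parseRecs 20000 (digitsOf (fsegs1 ++ fsegs2))) 64 64 = (3594932281151711600, 3597748240050475591, 1799838523185, 15348842465805949809298, 15726238600353375693198, true) := by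
  decide +kernel

set_option maxHeartbeats 0 in
/-- The head accumulators `(T⁺, T⁻, I, S⁺, S⁻, ok)` on `d ∈ [128, 256)`. [folklore] -/
theorem head_128 : headSums (parseRecs 20000 (digitsOf (fsegs1 ++ fsegs2))) 128 128 = (3269150886992673116, 3266465751565364077, 4330187146698, 15365344374665028352240, 15846360219085249036864, true) := by
  decide +kernel

set_option maxHeartbeats 0 in
/-- The head accumulators `(T⁺, T⁻, I, S⁺, S⁻, ok)` on `d ∈ [256, 512)`. [folklore] -/
theorem head_256 : headSums (parseRecs 20000 (digitsOf (fsegs1 ++ fsegs2))) 256 256 = (2931428011272823280, 2933449102113236750, 9533978039793, 15144891294508265911496, 16361658195969255763612, true) := by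
  decide +kernel

set_option maxHeartbeats 0 in
/-- The head accumulators `(T⁺, T⁻, I, S⁺, S⁻, ok)` on `d ∈ [512, 1024)`. [folklore] -/
theorem head_512 : headSums (parseRecs 20000 (digitsOf (fsegs1 ++ fsegs2))) 512 512 = (2605656077424947074, 2605010315748472856, 20114277474688, 14928545271464191537596, 17167910533908862787418, true) := by
  decide +kernel

set_option maxHeartbeats 0 in
/-- The head accumulators `(T⁺, T⁻, I, S⁺, S⁻, ok)` on `d ∈ [1024, 2048)`. [folklore] -/
theorem head_1024 : headSums (parseRecs 20000 (digitsOf (fsegs1 ++ fsegs2))) 1024 1024 = (2275430365419531484, 2271886349490094140, 41339683301764, 14201299650147664543612, 18662404228959557026249, true) := by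
  decide +kernel

end Literature.NumberTheory.Sieve.RomanovCert
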